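import Literature.Computability.Complexity.FlatProgLocality
import HarnessLib

/-!
# Flat programs: claims in OCCUPANCY form are sound and complete

Sequel of `FlatProgLocality.lean` (claim systems `FlatProg.Claims` about a flat run — program
counter, SIZES, bottom-indexed cells, tops — with local consistency, soundness and
completeness). A circuit claims bits, and the cheapest circuit-level presentation of a stack
avoids numerals for the sizes: per height `p` an OCCUPANCY bit ("stack `k` has a symbol at
height `p`"), so that every local condition is a constant-size Boolean combination of claimed
bits (no comparators or incrementers) — this is the presentation of `FlatRunClaims.lean`
(kinds `1` occupancy, `2` cell, `3` emptiness, `4` top). This file proves that the occupancy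
form loses nothing:

* `FlatProg.nextOcc`, `FlatProg.nextCellO` — the occupancy-form next-state functions (a push
  fills the first free cell, a pop frees the top one; a push writes into the cell that was free)
  and their agreement with the size form: `FlatProg.nextOcc_decide`, `FlatProg.nextCellO_decide`,
  `FlatProg.below_decide`;
* `FlatProg.OClaims` and **`FlatProg.OClaims.Consistent P nK T Pmax c₀`** — initial claims are
  those of `c₀`; height `Pmax` is free; emptiness is non-occupancy of height `0`; the top is the
  symbol at the occupancy boundary; occupancy and cells at `τ + 1` are `nextOcc` / `nextCellO` of
  the claims at `τ` (each condition mentions at most five claimed quantities);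
* **soundness** `FlatProg.OClaims.Consistent.sound`: if the sizes of the run stay below `Pmax`
  up to time `T`, consistent claims MATCH the run at every `τ ≤ T` (`OClaims.Matches`: program
  counter, occupancy up to `Pmax`, occupied cells; whence emptiness and tops,
  `empty_of_matches`, `top_of_matches`, `topOpt_of_matches`), by induction on `τ`
  (`matches_step`, over the locality lemmas `step_fst`, `ssize_step`, `cellB_step`,
  `nextCell_congr` of `FlatProgLocality.lean`);
* **completeness** `FlatProg.OClaims.consistent_ofRun`: under the same size bound the honest
  claims `OClaims.ofRun` are consistent.

The size bound is essential for soundness (a claimant could otherwise let a stack silently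
overflow height `Pmax`) and is supplied downstream by the budget of `FlatRunClaims.lean`
(`FlatClaim.length_stk_cfgAt_le`). Everything is proved; no named fact.

## References

* R. Williams, *Nonuniform ACC circuit lower bounds*, J. ACM 61(1) (2014) 2:1–2:32, Lemma 3.1
  and its proof (pp. 10–12: the consistency check of claimed gate values) [Williams2014].
* S. Arora, B. Barak, *Computational Complexity: A Modern Approach*, CUP 2009, §1.4
  (configurations of a machine and their one-step evolution) [AroraBarakCC2009].
-/

namespace Literature.Computability.Complexity

namespace FlatProg

open Function

/-! ### Next-state functions in occupancy form -/

/-- The next occupancy bit of height `p` of stack `k`, from the old bit `o`, the bit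
`below = (p = 0 ∨ height p - 1 occupied)` and the bit `above = (height p + 1 occupied)`: a push
on `k` fills the first free cell, a pop on `k` frees the top one. [cite: AroraBarakCC2009, §1.4] -/
def nextOcc (P : Prog) (nK pc k : ℕ) (o below above : Bool) : Bool :=
  match P[pc]? with
  | some (.push k' _ _) => if k' = k ∧ k < nK then (o || below) else o
  | some (.pop k' _) => if k' = k ∧ k < nK then (o && above) else o
  | _ => o

/-- The next content of an occupied cell, from its old occupancy bit `o` and old content `v`:
a push on `k` writes its symbol into the cell that was free. [cite: AroraBarakCC2009, §1.4] -/
def nextCellO (P : Prog) (nK pc k : ℕ) (o : Bool) (v : ℕ) : ℕ :=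
  match P[pc]? with
  | some (.push k' a _) => if k' = k ∧ k < nK ∧ o = false then a else v
  | _ => v

/-- **Occupancy form of the size transition**: with the true occupancy bits of a stack of size
`s`, `nextOcc` yields the occupancy bits of the stack of size `nextSize`. [folklore] -/
theorem nextOcc_decide (P : Prog) (nK pc k s p : ℕ) :
    nextOcc P nK pc k (decide (p < s)) (decide (p ≤ s)) (decide (p + 1 < s)) =
      decide (p < nextSize P nK pc k s) := by
  unfold nextOcc nextSize
  cases P[pc]? with
  | none => rfl
  | some i =>
    cases i with
    | goto j => rfl
    | push k' a j =>
      dsimp only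
      split_ifs with hk
      · rw [Bool.eq_iff_iff]
        simp only [Bool.or_eq_true, decide_eq_true_eq]
        omega
      · rfl
    | pop k' t =>
      dsimp only
      split_ifs with hk
      · rw [Bool.eq_iff_iff]
        simp only [Bool.and_eq_true, decide_eq_true_eq]
        omega
      · rfl

/-- **Occupancy form of the cell transition**: below the new size, `nextCellO` with the true old
occupancy bit agrees with `nextCell`. [folklore] -/
theorem nextCellO_decide (P : Prog) (nK pc k s p v : ℕ) (hp : p < nextSize P nK pc k s) :
    nextCellO P nK pc k (decide (p < s)) v = nextCell P nK pc k s p v := by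
  unfold nextSize at hp
  unfold nextCellO nextCell
  revert hp
  cases P[pc]? with
  | none => intro; rfl
  | some i =>
    cases i with
    | goto j => intro; rfl
    | push k' a j =>
      intro hp
      dsimp only at hp ⊢
      by_cases hk : k' = k ∧ k < nK
      · rw [if_pos hk] at hp
        by_cases hps : p < s
        · rw [if_neg (by rw [decide_eq_true hps]; simp), if_neg (fun h => by omega)]
        · have hpe : p = s := by omega
          rw [if_pos ⟨hk.1, hk.2, decide_eq_false hps⟩, if_pos ⟨hk.1, hk.2, hpe⟩]
      · rw [if_neg (fun h => hk ⟨h.1, h.2.1⟩), if_neg (fun h => hk ⟨h.1, h.2.1⟩)]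
    | pop k' t => intro; rfl

/-- The bit "`p = 0` or height `p - 1` is below the size" is "`p ≤ size`". [folklore] -/
theorem below_decide (s p : ℕ) : (decide (p = 0) || decide (p - 1 < s)) = decide (p ≤ s) := by
  rw [Bool.eq_iff_iff]
  simp only [Bool.or_eq_true, decide_eq_true_eq]
  omega

/-- The head of a nonempty stack is the cell below its size. [folklore] -/
theorem headD_stk_eq_cellB (c : Cfg) (k : ℕ) (h : ssize c k ≠ 0) :
    (stk c k).headD 0 = cellB c k (ssize c k - 1) := by
  have ht := top_eq_cellB c k
  rw [if_neg h, top] at ht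
  rw [List.headD_eq_head?_getD, ht]
  rfl

/-! ### Claims in occupancy form -/

/-- A system of claims about a flat run in OCCUPANCY form: program counter; per time, stack and
height an occupancy bit and a symbol; per time and stack an emptiness bit and a top symbol. All
quantities are Booleans or bounded numbers read in fixed width — the form in which a circuit
claims them (`FlatRunClaims.lean`, kinds `0`–`4`). [cite: Williams2014, Lemma 3.1 (proof)] -/
structure OClaims where
  /-- Claimed program counter at time `τ`. -/
  pc : ℕ → ℕ
  /-- Claimed occupancy of height `p` of stack `k` at time `τ`. -/
  occ : ℕ → ℕ → ℕ → Bool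
  /-- Claimed symbol at height `p` of stack `k` at time `τ`. -/
  cell : ℕ → ℕ → ℕ → ℕ
  /-- Claimed emptiness of stack `k` at time `τ`. -/
  empty : ℕ → ℕ → Bool
  /-- Claimed top symbol of stack `k` at time `τ` (junk if empty). -/
  top : ℕ → ℕ → ℕ

/-- The claimed top as an optional symbol. [folklore] -/
def OClaims.topOpt (C : OClaims) (τ k : ℕ) : Option ℕ :=
  if C.empty τ k = true then none else some (C.top τ k)

/-- The claimed bit "`p = 0` or height `p - 1` is occupied". [folklore] -/
def OClaims.below (C : OClaims) (τ k p : ℕ) : Bool := decide (p = 0) || C.occ τ k (p - 1)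

/-- **Local consistency in occupancy form** up to time `T` and height `Pmax`, for the program
`P` on `nK` stacks started in `c₀`: initial claims are those of `c₀`; occupancy is off at height
`Pmax`; emptiness is non-occupancy of height `0`; the top is the symbol at the occupancy
boundary; and the claims at `τ + 1` are the occupancy-form next-state functions of boundedly
many claims at `τ`. [cite: Williams2014, Lemma 3.1 (proof)] -/
structure OClaims.Consistent (P : Prog) (nK T Pmax : ℕ) (c₀ : Cfg) (C : OClaims) : Prop where
  /-- Initial program counter. -/
  init_pc : C.pc 0 = c₀.1
  /-- Initial occupancy. -/
  init_occ : ∀ k p, p ≤ Pmax → C.occ 0 k p = decide (p < ssize c₀ k)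
  /-- Initial cells. -/
  init_cell : ∀ k p, p < ssize c₀ k → C.cell 0 k p = cellB c₀ k p
  /-- Height `Pmax` is free. -/
  occ_max : ∀ τ, τ ≤ T → ∀ k, C.occ τ k Pmax = false
  /-- Emptiness. -/
  empty_eq : ∀ τ, τ ≤ T → ∀ k, C.empty τ k = !C.occ τ k 0
  /-- The top is the symbol at the boundary. -/
  top_eq : ∀ τ, τ ≤ T → ∀ k p, p < Pmax → C.occ τ k p = true → C.occ τ k (p + 1) = false →
    C.top τ k = C.cell τ k p
  /-- Program counter transition. -/
  pc_succ : ∀ τ, τ < T → C.pc (τ + 1) = nextPc P (C.pc τ) (C.topOpt τ)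
  /-- Occupancy transition (below height `Pmax`). -/
  occ_succ : ∀ τ, τ < T → ∀ k p, p < Pmax →
    C.occ (τ + 1) k p = nextOcc P nK (C.pc τ) k (C.occ τ k p) (C.below τ k p) (C.occ τ k (p + 1))
  /-- Cell transition (occupied cells). -/
  cell_succ : ∀ τ, τ < T → ∀ k p, p < Pmax → C.occ (τ + 1) k p = true →
    C.cell (τ + 1) k p = nextCellO P nK (C.pc τ) k (C.occ τ k p) (C.cell τ k p)

/-! ### Soundness -/

/-- The invariant of the soundness induction at a configuration `c`: the claimed program counter,
occupancy bits up to `Pmax` and occupied cells at time `τ` are those of `c`. [folklore] -/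
def OClaims.Matches (C : OClaims) (Pmax τ : ℕ) (c : Cfg) : Prop :=
  C.pc τ = c.1 ∧ (∀ k p, p ≤ Pmax → C.occ τ k p = decide (p < ssize c k)) ∧
    ∀ k p, p < ssize c k → C.cell τ k p = cellB c k p

/-- Matching claims bound the sizes by `Pmax` (height `Pmax` is claimed free). [folklore] -/
theorem OClaims.Consistent.ssize_le {P : Prog} {nK T Pmax : ℕ} {c₀ : Cfg} {C : OClaims}
    (h : C.Consistent P nK T Pmax c₀) {τ : ℕ} (hτ : τ ≤ T) {c : Cfg} (hm : C.Matches Pmax τ c)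
    (k : ℕ) : ssize c k ≤ Pmax := by
  have h1 := hm.2.1 k Pmax le_rfl
  rw [h.occ_max τ hτ k] at h1
  exact not_lt.1 (of_decide_eq_false h1.symm)

/-- Matching claims have the true emptiness bits. [folklore] -/
theorem OClaims.Consistent.empty_of_matches {P : Prog} {nK T Pmax : ℕ} {c₀ : Cfg} {C : OClaims}
    (h : C.Consistent P nK T Pmax c₀) {τ : ℕ} (hτ : τ ≤ T) {c : Cfg} (hm : C.Matches Pmax τ c)
    (k : ℕ) : C.empty τ k = decide (ssize c k = 0) := by
  rw [h.empty_eq τ hτ k, hm.2.1 k 0 (Nat.zero_le _)]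
  rcases Nat.eq_zero_or_pos (ssize c k) with h0 | h0
  · rw [h0]; rfl
  · rw [decide_eq_true h0, decide_eq_false (by omega)]; rfl

/-- Matching claims have the true top symbol of a nonempty stack. [folklore] -/
theorem OClaims.Consistent.top_of_matches {P : Prog} {nK T Pmax : ℕ} {c₀ : Cfg} {C : OClaims}
    (h : C.Consistent P nK T Pmax c₀) {τ : ℕ} (hτ : τ ≤ T) {c : Cfg} (hm : C.Matches Pmax τ c)
    (k : ℕ) (hs : ssize c k ≠ 0) : C.top τ k = (stk c k).headD 0 := by
  have hsP := h.ssize_le hτ hm k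
  have hs' : 0 < ssize c k := Nat.pos_of_ne_zero hs
  rw [h.top_eq τ hτ k (ssize c k - 1) (by omega)
      (by rw [hm.2.1 k _ (by omega), decide_eq_true (by omega)])
      (by rw [Nat.sub_add_cancel hs', hm.2.1 k _ hsP, decide_eq_false (lt_irrefl _)]),
    hm.2.2 k _ (by omega), headD_stk_eq_cellB c k hs]

/-- Matching claims have the true tops, as optional symbols. [folklore] -/
theorem OClaims.Consistent.topOpt_of_matches {P : Prog} {nK T Pmax : ℕ} {c₀ : Cfg} {C : OClaims}
    (h : C.Consistent P nK T Pmax c₀) {τ : ℕ} (hτ : τ ≤ T) {c : Cfg} (hm : C.Matches Pmax τ c) :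
    C.topOpt τ = FlatProg.top c := by
  funext k
  rw [OClaims.topOpt, h.empty_of_matches hτ hm k, top_eq_cellB]
  by_cases hs : ssize c k = 0
  · rw [decide_eq_true hs, if_pos rfl, if_pos hs]
  · rw [decide_eq_false hs, if_neg Bool.false_ne_true, if_neg hs, h.top_of_matches hτ hm k hs,
      headD_stk_eq_cellB c k hs]

/-- **One step of the soundness induction**: if the claims at `τ < T` match `c` (with `nK`
stacks) and the sizes after the step stay below `Pmax`, the claims at `τ + 1` match `step P c`.
[cite: Williams2014, Lemma 3.1 (proof)] -/
theorem OClaims.Consistent.matches_step {P : Prog} {nK T Pmax : ℕ} {c₀ : Cfg} {C : OClaims}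
    (h : C.Consistent P nK T Pmax c₀) {τ : ℕ} (hτ : τ < T) {c : Cfg} (hlen : c.2.length = nK)
    (hm : C.Matches Pmax τ c) (hsz : ∀ k, ssize (step P c) k < Pmax) :
    C.Matches Pmax (τ + 1) (step P c) := by
  obtain ⟨hpc, hocc, hcell⟩ := hm
  have hτ' : τ ≤ T := hτ.le
  have hbelow : ∀ k p, p ≤ Pmax → C.below τ k p = decide (p ≤ ssize c k) := by
    intro k p hp
    rw [OClaims.below, hocc k (p - 1) (by omega), below_decide]
  -- occupancy first
  have hocc1 : ∀ k p, p ≤ Pmax → C.occ (τ + 1) k p = decide (p < ssize (step P c) k) := by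
    intro k p hp
    rcases hp.lt_or_eq with hlt | rfl
    · rw [h.occ_succ τ hτ k p hlt, hocc k p hp, hbelow k p hp, hocc k (p + 1) (by omega), hpc,
        nextOcc_decide, ssize_step, hlen]
    · rw [h.occ_max (τ + 1) hτ k, decide_eq_false (by have := hsz k; omega)]
  refine ⟨?_, hocc1, ?_⟩
  · rw [h.pc_succ τ hτ, hpc, h.topOpt_of_matches hτ' ⟨hpc, hocc, hcell⟩, step_fst]
  · intro k p hp
    have hpP : p < Pmax := lt_trans hp (hsz k)
    have hp' : p < nextSize P nK c.1 k (ssize c k) := by rw [← hlen, ← ssize_step]; exact hp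
    rw [h.cell_succ τ hτ k p hpP (by rw [hocc1 k p hpP.le, decide_eq_true hp]), hocc k p hpP.le,
      hpc, nextCellO_decide P nK c.1 k _ p _ hp', cellB_step P c k p hp, hlen]
    by_cases hps : p < ssize c k
    · rw [hcell k p hps]
    · exact nextCell_congr _ _ hp' hps

/-- **Soundness: consistent occupancy-form claims are the truth.** If the sizes of the run stay
below `Pmax` up to time `T`, then at every `τ ≤ T` the claims match the configuration
`(step P)^[τ] c₀` — program counter, occupancy, occupied cells (`Matches`), hence also emptiness
and tops (`empty_of_matches`, `top_of_matches`). [cite: Williams2014, Lemma 3.1 (proof)] -/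
theorem OClaims.Consistent.sound {P : Prog} {nK T Pmax : ℕ} {c₀ : Cfg} {C : OClaims}
    (h : C.Consistent P nK T Pmax c₀) (hnK : c₀.2.length = nK)
    (hsz : ∀ τ, τ ≤ T → ∀ k, ssize ((step P)^[τ] c₀) k < Pmax) :
    ∀ τ, τ ≤ T → C.Matches Pmax τ ((step P)^[τ] c₀) := by
  intro τ
  induction τ with
  | zero => intro _; exact ⟨h.init_pc, h.init_occ, h.init_cell⟩
  | succ τ ih =>
    intro hτ
    rw [iterate_succ_apply']
    refine h.matches_step hτ (by rw [length_iterate, hnK]) (ih (by omega)) fun k => ?_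
    have := hsz (τ + 1) hτ k
    rwa [iterate_succ_apply'] at this

/-! ### Completeness -/

/-- **The honest occupancy-form claims** of the run of `P` from `c₀`. [folklore] -/
def OClaims.ofRun (P : Prog) (c₀ : Cfg) : OClaims where
  pc τ := ((step P)^[τ] c₀).1
  occ τ k p := decide (p < ssize ((step P)^[τ] c₀) k)
  cell τ k p := cellB ((step P)^[τ] c₀) k p
  empty τ k := decide (ssize ((step P)^[τ] c₀) k = 0)
  top τ k := (stk ((step P)^[τ] c₀) k).headD 0

/-- The honest claims match the run. [folklore] -/
theorem OClaims.matches_ofRun (P : Prog) (c₀ : Cfg) (Pmax τ : ℕ) :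
    (OClaims.ofRun P c₀).Matches Pmax τ ((step P)^[τ] c₀) :=
  ⟨rfl, fun _ _ _ => rfl, fun _ _ _ => rfl⟩

/-- The honest optional tops are the tops. [folklore] -/
theorem OClaims.topOpt_ofRun (P : Prog) (c₀ : Cfg) (τ : ℕ) :
    (OClaims.ofRun P c₀).topOpt τ = FlatProg.top ((step P)^[τ] c₀) := by
  funext k
  set c := (step P)^[τ] c₀ with hc
  show (if decide (ssize c k = 0) = true then none else some ((stk c k).headD 0)) = FlatProg.top c k
  rw [top_eq_cellB]
  by_cases hs : ssize c k = 0
  · rw [decide_eq_true hs, if_pos rfl, if_pos hs]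
  · rw [decide_eq_false hs, if_neg Bool.false_ne_true, if_neg hs, headD_stk_eq_cellB c k hs]

/-- **Completeness: the honest occupancy-form claims are consistent**, provided the sizes stay
below `Pmax` up to time `T`. [cite: Williams2014, Lemma 3.1 (proof)] -/
theorem OClaims.consistent_ofRun (P : Prog) (c₀ : Cfg) (T Pmax : ℕ)
    (hsz : ∀ τ, τ ≤ T → ∀ k, ssize ((step P)^[τ] c₀) k < Pmax) :
    (OClaims.ofRun P c₀).Consistent P c₀.2.length T Pmax c₀ where
  init_pc := rfl
  init_occ _ _ _ := rfl
  init_cell _ _ _ := rfl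
  occ_max τ hτ k := decide_eq_false (by have := hsz τ hτ k; omega)
  empty_eq τ _ k := by
    show decide (ssize ((step P)^[τ] c₀) k = 0) = !decide (0 < ssize ((step P)^[τ] c₀) k)
    rcases Nat.eq_zero_or_pos (ssize ((step P)^[τ] c₀) k) with h0 | h0
    · rw [h0]; rfl
    · rw [decide_eq_true h0, decide_eq_false (by omega)]; rfl
  top_eq τ _ k p _ h1 h2 := by
    change decide (p < ssize ((step P)^[τ] c₀) k) = true at h1
    change decide (p + 1 < ssize ((step P)^[τ] c₀) k) = false at h2
    show (stk ((step P)^[τ] c₀) k).headD 0 = cellB ((step P)^[τ] c₀) k p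
    have h1' := of_decide_eq_true h1
    have h2' := of_decide_eq_false h2
    rw [headD_stk_eq_cellB _ k (by omega)]
    congr 1
    omega
  pc_succ τ _ := by
    show ((step P)^[τ + 1] c₀).1 = nextPc P ((step P)^[τ] c₀).1 ((OClaims.ofRun P c₀).topOpt τ)
    rw [OClaims.topOpt_ofRun, iterate_succ_apply', step_fst]
  occ_succ τ _ k p _ := by
    show decide (p < ssize ((step P)^[τ + 1] c₀) k) =
      nextOcc P c₀.2.length ((step P)^[τ] c₀).1 k (decide (p < ssize ((step P)^[τ] c₀) k))
        (decide (p = 0) || decide (p - 1 < ssize ((step P)^[τ] c₀) k))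
        (decide (p + 1 < ssize ((step P)^[τ] c₀) k))
    rw [below_decide, nextOcc_decide, iterate_succ_apply', ssize_step, length_iterate]
  cell_succ τ _ k p _ hocc := by
    change decide (p < ssize ((step P)^[τ + 1] c₀) k) = true at hocc
    show cellB ((step P)^[τ + 1] c₀) k p =
      nextCellO P c₀.2.length ((step P)^[τ] c₀).1 k (decide (p < ssize ((step P)^[τ] c₀) k))
        (cellB ((step P)^[τ] c₀) k p)
    have hp := of_decide_eq_true hocc
    rw [iterate_succ_apply'] at hp ⊢
    have hp' : p < nextSize P c₀.2.length ((step P)^[τ] c₀).1 k (ssize ((step P)^[τ] c₀) k) := by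
      rw [← length_iterate P c₀ τ, ← ssize_step]; exact hp
    rw [cellB_step P _ k p hp, length_iterate, nextCellO_decide P _ _ k _ p _ hp']

end FlatProg

end Literature.Computability.Complexity
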